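import Mathlib
import Summits.ResolutionOfSingularities.ResolutionOfSingularities.Theorems.WildQuotientsWildQuotientResolutionToricExitParity
import Summits.ResolutionOfSingularities.ResolutionOfSingularities.Theorems.WildQuotientsWildQuotientResolutionToricExitRootChartFixed
import Summits.ResolutionOfSingularities.ResolutionOfSingularities.Theorems.WildQuotientsWildQuotientResolutionToricExitRootChartEven
import Summits.ResolutionOfSingularities.ResolutionOfSingularities.Theorems.WildQuotientsWildQuotientResolutionToricExitConeDefs

/-!
# V3U chart a, C2 — THE HEART: the invariants of the root-chart action on the even subring are the `A₁`-cone

(crux stmt-ResolutionOfSingularities-15640 `WildQuotients.WildQuotientResolution`, line `Sketch`,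
sector `|G| = p`; programme V3U «toric exit» of `L/w45c/CHAIN.md` v5 §4 row stub-1, candidate C2
`chartA_fixedPoints_eq` of `L/w45c/W45cPlanSignaturesV5.lean` (planner res-L1-w45c-plan-1),
signature verbatim (with `ToricExit.chartAGens`, p486722, and stub-4's `ToricExit.coneGens`,
…ToricExitConeDefs); [OURS · L1 W4.5c] — NOT a statement of any manuscript; replaces the role of no
printed item.)

`chartA_fixedPoints_eq`: for the root-chart action `σ_U` (`ρ ↦ ρ`, `β ↦ β + ρ`, `x_c ↦ x_c + ρβ`,
passengers fixed) in characteristic `p ≥ 3`,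
`{f ∈ k[ρ², ρβ, β², x_c, passengers] | σ_U f = f} = k[ρ², ρN, N², c′, passengers]`,
`N = β^p − ρ^{p−1}β`, `c′ = x_c − ½(β² − ρβ)` — the coordinate ring of the `A₁`-cone `× 𝔸^{n−2}`.
Proof (step (iv) of the plan): a fixed `f` lies in `k[N, c′, xᵢ (i ≠ b, c)]`
(`mem_adjoin_of_rootChart_eq`, p488511), i.e. `f = P(ρ, N, c′, passengers)` for a polynomial `P`
(`aeval` of the generator family `g`); for the PARITY grading `w` (`w a = w b = 1`, else `0`) the
generators `ρ = g a`, `N = g b` are odd and `c′ = g c`, `xᵢ = g i` even, so `aeval g` preserves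
`w`-degrees (`isWeightedHomogeneous_aeval`); `f` is even (`mem_adjoin_even_iff`, p487517), hence
`f = aeval g P₀` for the even part `P₀` of `P` (the image of the odd part is both even and odd, so
`0`), and `P₀ ∈ k[y_a², y_a y_b, y_b², yᵢ (i ≠ a, b)]` maps onto `k[ρ², ρN, N², c′, passengers]`.
No algebraic independence of `ρ, N, c′` is used (that is C3, stub-4).
-/

-- single-problem summit: the doubled namespace component `ResolutionOfSingularities` is forced
set_option linter.dupNamespace false

noncomputable section

open MvPolynomial

namespace Summit.ResolutionOfSingularities.ResolutionOfSingularities.Theorems.WildQuotientResolution.ToricExit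

/-- **Substitution preserves weighted degrees** when each substituted element `g i` is weighted
homogeneous of degree `w₁ i` for the target weight `w₂`. [folklore] -/
theorem isWeightedHomogeneous_aeval {ι τ R M : Type*} [CommRing R] [AddCommMonoid M]
    (w₁ : ι → M) (w₂ : τ → M) (g : ι → MvPolynomial τ R)
    (hg : ∀ i, IsWeightedHomogeneous w₂ (g i) (w₁ i)) (P : MvPolynomial ι R) (d : M)
    (hP : IsWeightedHomogeneous w₁ P d) : IsWeightedHomogeneous w₂ (aeval g P) d := by
  classical
  rw [P.as_sum, map_sum]
  refine IsWeightedHomogeneous.sum _ _ _ fun m hm => ?_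
  have hd : Finsupp.weight w₁ m = d := hP (mem_support_iff.mp hm)
  have hprod : IsWeightedHomogeneous w₂ (m.prod fun i e => g i ^ e) (Finsupp.weight w₁ m) := by
    rw [Finsupp.prod, Finsupp.weight_apply, Finsupp.sum]
    exact IsWeightedHomogeneous.prod _ _ _ fun i _ => (hg i).pow (m i)
  have h := (isWeightedHomogeneous_C w₂ (coeff m P)).mul hprod
  rw [zero_add, hd] at h
  rwa [aeval_monomial, MvPolynomial.algebraMap_eq]

/-- In `ZMod 2` an odd natural number is `1`. [folklore] -/
theorem natCast_zmod_two_of_odd {p : ℕ} (hp : Odd p) : (p : ZMod 2) = 1 := by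
  obtain ⟨m, rfl⟩ := hp
  rw [Nat.cast_add, Nat.cast_mul, show ((2 : ℕ) : ZMod 2) = 0 from rfl, zero_mul, zero_add,
    Nat.cast_one]

/-- **C2 `chartA_fixedPoints_eq` — THE HEART of V3U** (V5 §C, signature verbatim): the
`σ_U`-invariants of the even subring `k[ρ², ρβ, β², x_c, …]` are exactly the cone algebra
`k[ρ², ρN, N², c′, …]` (`p ≥ 3`). See the module docstring for the route. [OURS · L1 W4.5c] -/
theorem chartA_fixedPoints_eq (p : ℕ) (hp : p.Prime) (hp3 : 3 ≤ p) (k : Type) [Field k] [CharP k p]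
    (n : ℕ) (σU : MvPolynomial (Fin n) k ≃ₐ[k] MvPolynomial (Fin n) k) (a b c : Fin n)
    (hab : a ≠ b) (hbc : b ≠ c) (hac : a ≠ c)
    (hb : σU (X b) = X b + X a) (hc : σU (X c) = X c + X a * X b)
    (hσ : ∀ i, i ≠ b → i ≠ c → σU (X i) = X i) :
    {f : MvPolynomial (Fin n) k | f ∈ Algebra.adjoin k (chartAGens k n a b) ∧ σU f = f} =
      (Algebra.adjoin k (coneGens k p n a b c) : Set (MvPolynomial (Fin n) k)) := by
  classical
  -- `2 ≠ 0` and `p` odd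
  have h2 : (2 : k) ≠ 0 := by
    intro h
    have hdvd : p ∣ 2 := (CharP.cast_eq_zero_iff k p 2).mp (by exact_mod_cast h)
    have := Nat.le_of_dvd two_pos hdvd
    omega
  have hpodd : (p : ZMod 2) = 1 := natCast_zmod_two_of_odd (hp.odd_of_ne_two (by omega))
  have hp1 : p - 1 + 1 = p := Nat.sub_add_cancel hp.one_lt.le
  have ha : σU (X a) = X a := hσ a hab hac
  -- the parity weight
  let w : Fin n → ZMod 2 := fun i => if i = a ∨ i = b then 1 else 0
  have hwa : w a = 1 := if_pos (Or.inl rfl)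
  have hwb : w b = 1 := if_pos (Or.inr rfl)
  have hw0 : ∀ i, i ≠ a → i ≠ b → w i = 0 := fun i hia hib => if_neg (not_or.mpr ⟨hia, hib⟩)
  have hwc : w c = 0 := hw0 c (Ne.symm hac) (Ne.symm hbc)
  -- the invariant generators and their parities
  set N : MvPolynomial (Fin n) k := X b ^ p - X a ^ (p - 1) * X b with hN
  set c' : MvPolynomial (Fin n) k := X c - C (2⁻¹ : k) * (X b ^ 2 - X a * X b) with hc'
  have hXa : IsWeightedHomogeneous w (X a : MvPolynomial (Fin n) k) 1 := by
    have h := isWeightedHomogeneous_X k w a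
    rwa [hwa] at h
  have hXb : IsWeightedHomogeneous w (X b : MvPolynomial (Fin n) k) 1 := by
    have h := isWeightedHomogeneous_X k w b
    rwa [hwb] at h
  have hXc : IsWeightedHomogeneous w (X c : MvPolynomial (Fin n) k) 0 := by
    have h := isWeightedHomogeneous_X k w c
    rwa [hwc] at h
  have e11 : (1 : ZMod 2) + 1 = 0 := one_add_one_zmod_two
  have hNodd : IsWeightedHomogeneous w N 1 := by
    have h1 : IsWeightedHomogeneous w (X b ^ p : MvPolynomial (Fin n) k) 1 := by
      have h := hXb.pow p
      rwa [nsmul_eq_mul, mul_one, hpodd] at h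
    have h2' : IsWeightedHomogeneous w (X a ^ (p - 1) * X b : MvPolynomial (Fin n) k) 1 := by
      have h := (hXa.pow (p - 1)).mul hXb
      rwa [nsmul_eq_mul, mul_one, ← Nat.cast_add_one, hp1, hpodd] at h
    exact (weightedHomogeneousSubmodule k w 1).sub_mem h1 h2'
  have hc'even : IsWeightedHomogeneous w c' 0 := by
    have hbb : IsWeightedHomogeneous w (X b ^ 2 : MvPolynomial (Fin n) k) 0 := by
      have h := hXb.mul hXb
      rwa [← sq, e11] at h
    have hab' : IsWeightedHomogeneous w (X a * X b : MvPolynomial (Fin n) k) 0 := by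
      have h := hXa.mul hXb
      rwa [e11] at h
    exact (weightedHomogeneousSubmodule k w 0).sub_mem hXc
      (((weightedHomogeneousSubmodule k w 0).sub_mem hbb hab').C_mul (2⁻¹ : k))
  -- the generator family `g` and its parity
  let g : Fin n → MvPolynomial (Fin n) k := fun i => if i = b then N else if i = c then c' else X i
  have hgb : g b = N := if_pos rfl
  have hgc : g c = c' := by
    change (if c = b then N else if c = c then c' else X c) = c'
    rw [if_neg (Ne.symm hbc), if_pos rfl]
  have hgi : ∀ i, i ≠ b → i ≠ c → g i = X i := by
    intro i hib hic
    change (if i = b then N else if i = c then c' else X i) = X i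
    rw [if_neg hib, if_neg hic]
  have hga : g a = X a := hgi a hab hac
  have hgw : ∀ i, IsWeightedHomogeneous w (g i) (w i) := by
    intro i
    by_cases hib : i = b
    · subst hib
      rw [hgb, hwb]
      exact hNodd
    · by_cases hic : i = c
      · subst hic
        rw [hgc, hwc]
        exact hc'even
      · rw [hgi i hib hic]
        exact isWeightedHomogeneous_X k w i
  -- `k[N, c', xᵢ (i ≠ b, c)] ≤ range (aeval g)`
  have hFle : Algebra.adjoin k (({X b ^ p - X a ^ (p - 1) * X b,
      X c - C (2⁻¹ : k) * (X b ^ 2 - X a * X b)} : Set (MvPolynomial (Fin n) k)) ∪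
        ((fun i => X i) '' {i | i ≠ b ∧ i ≠ c})) ≤
      (aeval g : MvPolynomial (Fin n) k →ₐ[k] MvPolynomial (Fin n) k).range := by
    refine Algebra.adjoin_le ?_
    rintro x hx
    rcases hx with hx | ⟨i, ⟨hib, hic⟩, rfl⟩
    · simp only [Set.mem_insert_iff, Set.mem_singleton_iff] at hx
      rcases hx with rfl | rfl
      · exact (AlgHom.mem_range _).mpr ⟨X b, by rw [aeval_X, hgb]⟩
      · exact (AlgHom.mem_range _).mpr ⟨X c, by rw [aeval_X, hgc]⟩
    · exact (AlgHom.mem_range _).mpr ⟨X i, by rw [aeval_X, hgi i hib hic]⟩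
  -- the images of the even generators are the cone generators
  have himg : Subalgebra.map (aeval g : MvPolynomial (Fin n) k →ₐ[k] MvPolynomial (Fin n) k)
      (Algebra.adjoin k (chartAGens k n a b)) ≤ Algebra.adjoin k (coneGens k p n a b c) := by
    rw [AlgHom.map_adjoin]
    refine Algebra.adjoin_le ?_
    rintro _ ⟨x, hx, rfl⟩
    rcases hx with hx | ⟨i, ⟨hia, hib⟩, rfl⟩
    · simp only [Set.mem_insert_iff, Set.mem_singleton_iff] at hx
      rcases hx with rfl | rfl | rfl
      · rw [map_pow, aeval_X, hga]
        exact Algebra.subset_adjoin (Or.inl (Set.mem_insert _ _))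
      · rw [map_mul, aeval_X, aeval_X, hga, hgb]
        exact Algebra.subset_adjoin (Or.inl (Set.mem_insert_of_mem _ (Set.mem_insert _ _)))
      · rw [map_pow, aeval_X, hgb]
        exact Algebra.subset_adjoin
          (Or.inl (Set.mem_insert_of_mem _ (Set.mem_insert_of_mem _ (Set.mem_insert _ _))))
    · by_cases hic : i = c
      · subst hic
        change aeval g (X i) ∈ _
        rw [aeval_X, hgc]
        exact Algebra.subset_adjoin (Or.inl (Set.mem_insert_of_mem _
          (Set.mem_insert_of_mem _ (Set.mem_insert_of_mem _ (Set.mem_singleton _)))))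
      · change aeval g (X i) ∈ _
        rw [aeval_X, hgi i hib hic]
        exact Algebra.subset_adjoin (Or.inr ⟨i, ⟨hia, hib, hic⟩, rfl⟩)
  apply Set.Subset.antisymm
  · -- `⊆`: an even fixed `f` is `aeval g` of an even polynomial
    rintro f ⟨hfS, hfσ⟩
    have hf0 : IsWeightedHomogeneous w f 0 :=
      isWeightedHomogeneous_of_mem_adjoin k n a b w hwa hwb hw0 f hfS
    have hfF := mem_adjoin_of_rootChart_eq k n σU a b c hab hbc hac hb hc hσ p hp hp3 f hfσ
    obtain ⟨P, hP⟩ := (AlgHom.mem_range _).mp (hFle hfF)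
    have hPdec := eq_add_weightedHomogeneousComponent k n w P
    have hP₀ : IsWeightedHomogeneous w (weightedHomogeneousComponent w 0 P) 0 :=
      weightedHomogeneousComponent_isWeightedHomogeneous 0 P
    have hP₁ : IsWeightedHomogeneous w (weightedHomogeneousComponent w 1 P) 1 :=
      weightedHomogeneousComponent_isWeightedHomogeneous 1 P
    have h0 := isWeightedHomogeneous_aeval w w g hgw _ 0 hP₀
    have h1 := isWeightedHomogeneous_aeval w w g hgw _ 1 hP₁
    have hsum : aeval g (weightedHomogeneousComponent w 0 P) +
        aeval g (weightedHomogeneousComponent w 1 P) = f := by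
      rw [← map_add, ← hPdec, hP]
    have h1' : IsWeightedHomogeneous w (aeval g (weightedHomogeneousComponent w 1 P)) 0 := by
      have e : aeval g (weightedHomogeneousComponent w 1 P) =
          f - aeval g (weightedHomogeneousComponent w 0 P) := by rw [← hsum]; ring
      rw [e]
      exact (weightedHomogeneousSubmodule k w 0).sub_mem hf0 h0
    have hz : aeval g (weightedHomogeneousComponent w 1 P) = 0 :=
      eq_zero_of_isWeightedHomogeneous_zero_one k n w _ h1' h1
    have hfP₀ : f = aeval g (weightedHomogeneousComponent w 0 P) := by
      rw [← hsum, hz, add_zero]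
    have hP₀mem : weightedHomogeneousComponent w 0 P ∈ Algebra.adjoin k (chartAGens k n a b) :=
      mem_adjoin_of_isWeightedHomogeneous k n a b hab w hwa hwb hw0 _ hP₀
    rw [hfP₀]
    exact himg (Subalgebra.mem_map.mpr ⟨_, hP₀mem, rfl⟩)
  · -- `⊇`: the cone generators are even and fixed
    intro f hf
    have hle : Algebra.adjoin k (coneGens k p n a b c) ≤
        Algebra.adjoin k (chartAGens k n a b) ⊓
          AlgHom.equalizer (σU : MvPolynomial (Fin n) k →ₐ[k] MvPolynomial (Fin n) k)
            (AlgHom.id k (MvPolynomial (Fin n) k)) := by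
      refine Algebra.adjoin_le ?_
      intro x hx
      rw [SetLike.mem_coe, Algebra.mem_inf, AlgHom.mem_equalizer, AlgHom.id_apply]
      change x ∈ Algebra.adjoin k (chartAGens k n a b) ∧ σU x = x
      have hσN : σU N = N := rootChart_artinSchreier k n σU a b c hab hac hb hσ p hp
      rcases hx with hx | ⟨i, ⟨hia, hib, hic⟩, rfl⟩
      · simp only [Set.mem_insert_iff, Set.mem_singleton_iff] at hx
        rcases hx with rfl | rfl | rfl | rfl
        · refine ⟨mem_adjoin_of_isWeightedHomogeneous k n a b hab w hwa hwb hw0 _ ?_, ?_⟩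
          · have h := hXa.mul hXa
            rwa [← sq, e11] at h
          · rw [map_pow, ha]
        · refine ⟨mem_adjoin_of_isWeightedHomogeneous k n a b hab w hwa hwb hw0 _ ?_, ?_⟩
          · have h := hXa.mul hNodd
            rwa [e11] at h
          · rw [map_mul, ha, hσN]
        · refine ⟨mem_adjoin_of_isWeightedHomogeneous k n a b hab w hwa hwb hw0 _ ?_, ?_⟩
          · have h := hNodd.mul hNodd
            rwa [← sq, e11] at h
          · rw [map_pow, hσN]
        · exact ⟨mem_adjoin_of_isWeightedHomogeneous k n a b hab w hwa hwb hw0 _ hc'even,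
            rootChart_cPrime k n σU a b c hab hac hb hc hσ h2⟩
      · exact ⟨Algebra.subset_adjoin (Or.inr ⟨i, ⟨hia, hib⟩, rfl⟩), hσ i hib hic⟩
    have h := hle hf
    rw [Algebra.mem_inf, AlgHom.mem_equalizer, AlgHom.id_apply] at h
    exact ⟨h.1, h.2⟩

end Summit.ResolutionOfSingularities.ResolutionOfSingularities.Theorems.WildQuotientResolution.ToricExit

end
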